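import Summits.QuantumAdvantage.AdviceFreeQNC0.AffBells29Peeling
import Summits.QuantumAdvantage.AdviceFreeQNC0.AffBells28Anf
import HarnessLib

/-!
# Expansion29 — S1 of ROUND-28 rev. 3 §6(b) (planner qn-p1 g29; prover ask P-29f)

Written against the LANDED tree files (`AffBells29Peeling`, `AffBells28Anf`), not against Sketch29.

* `rel_iff_fires` — the win indicator on a fibre as the parity of `fires β c (act x) x' + N + zeros + pairs2` (Q0 + `activeOnes_affBell`).
* `mem_subFibre_pair` — the 2-coin sub-fibre `SubFibre x {i,j}` is `{x, flipAt x {i,j}}`.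
* **`cubeWitness_pair_iff` (S1a, PROVED):** for distinct coins `i, j` of an odd point `x`, a CUBE WITNESS at the 2-window `(x, {i,j})` is
  EXACTLY a win-changing pair flip: `CubeWitness β c x {i,j} ↔ ¬ (win x ↔ win (flipAt x {i,j}))`.  Hence the mass of `CubeWitness` under the
  uniform coin-PAIR law (`unifLaw 2` of Sketch29 §29.12) is the normalised PAIR-CUT of the win set inside each fibre — the quantity `HPure`
  conditions on.
* `FibreCutBound` (S1b, statement only; prover target): the edge-isoperimetric inequality of the pair-flip Cayley graph on a fibre
  (`Cay(even-weight code of 𝔽₂^z, {e_i + e_j})`, eigenvalues `((z − 2|u|)² − z)/2`, Laplacian gap `2(z − 1)`):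
  `4 (z − 1) · |W| · |F ∖ W| ≤ |F| · cut(W)` for every `W ⊆ F`, `cut` counting ordered (point, pair) incidences whose flip crosses `W`.
  Any `poly(z)`-lossy version suffices downstream (S1c: small pair-cut mass ⇒ `win` is close to a function of the kernel line).
-/

namespace Summit.QuantumAdvantage.AdviceFreeQNC0

namespace AffBells29

open Finset Literature.Computability.QuantumComplexity Literature.Computability.QuantumComplexity.RingHLF
open AffBells23 AffBells26 Fib19 AffBells27 AffBells28

variable {N : ℕ}

/-- The win indicator on the fibre of `x`, as a parity of `fires` over the active rows of `x` (Q0 `targetFormula` + `activeOnes_affBell`). -/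
theorem rel_iff_fires (hN : 3 ≤ N) (β : Fin N → Fin N → ZMod 3) (c : Fin N → ZMod 3) {x x' : Fin N → Bool}
    (hx' : IsOdd x') (hk : kline x' = kline x) :
    RingHLF.Rel x' (affBell β c x') ↔ (fires β c (act x) x' + N + zeros (kline x) + pairs2 (kline x)) % 2 = 0 := by
  have h := targetFormula N hN x' hx' (affBell β c x')
  rw [activeOnes_affBell β c hk, hk] at h
  exact h

/-- Auxiliary `pair_subset_klineZeros` (planner qa-qnc0-p1 g29, `Expansion29.lean` sha16 1e9effd5fcfbc201, verbatim). -/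
theorem pair_subset_klineZeros {x : Fin N → Bool} {i j : Fin N} (hi : i ∈ klineZeros x) (hj : j ∈ klineZeros x) :
    ({i, j} : Finset (Fin N)) ⊆ klineZeros x := by
  intro k hk
  simp only [mem_insert, mem_singleton] at hk
  rcases hk with rfl | rfl <;> assumption

/-- The 2-coin sub-fibre has exactly the two points `x` and `flipAt x {i,j}`. -/
theorem mem_subFibre_pair (hN : 3 ≤ N) {x : Fin N → Bool} (hx : IsOdd x) {i j : Fin N} (hi : i ∈ klineZeros x)
    (hj : j ∈ klineZeros x) (hij : i ≠ j) {x' : Fin N → Bool} (hx' : x' ∈ SubFibre x {i, j}) :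
    x' = x ∨ x' = flipAt x {i, j} := by
  rw [AffBells28lit.subFibre_eq_image hN hx (pair_subset_klineZeros hi hj)] at hx'
  obtain ⟨P, hP, rfl⟩ := mem_image.1 hx'
  obtain ⟨hPsub, -⟩ := mem_filter.1 hP
  rw [mem_powerset] at hPsub
  by_cases hP0 : P = ∅
  · left
    subst hP0
    funext k
    simp [flipAt]
  · right
    have hle : P.card ≤ 2 := (card_le_card hPsub).trans (by rw [card_pair hij])
    have hpos : 0 < P.card := card_pos.2 (nonempty_iff_ne_empty.2 hP0)
    have heven : P.card % 2 = 0 := (mem_filter.1 hP).2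
    have hcard : P.card = 2 := by omega
    rw [eq_of_subset_of_card_le hPsub (by rw [card_pair hij, hcard])]

/-- **S1a (PROVED).** At a 2-window a cube witness is exactly a win-changing flip of the coin pair. -/
theorem cubeWitness_pair_iff (hN : 3 ≤ N) (β : Fin N → Fin N → ZMod 3) (c : Fin N → ZMod 3) {x : Fin N → Bool}
    (hx : IsOdd x) {i j : Fin N} (hi : i ∈ klineZeros x) (hj : j ∈ klineZeros x) (hij : i ≠ j) :
    CubeWitness β c x {i, j} ↔
      ¬ (RingHLF.Rel x (affBell β c x) ↔ RingHLF.Rel (flipAt x {i, j}) (affBell β c (flipAt x {i, j}))) := by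
  have hC : ({i, j} : Finset (Fin N)) ⊆ klineZeros x := pair_subset_klineZeros hi hj
  have hxm : x ∈ SubFibre x {i, j} := self_mem_subFibre hx _
  have hfm : flipAt x {i, j} ∈ SubFibre x {i, j} := flipAt_pair_mem_subFibre hN hC hxm (by simp) (by simp) hij
  have hf := hfm
  simp only [SubFibre, mem_filter, mem_univ, true_and] at hf
  obtain ⟨hoddf, hkf, -⟩ := hf
  have h1 := rel_iff_fires hN β c hx rfl
  have h2 := rel_iff_fires hN β c hoddf hkf
  constructor
  · rintro ⟨x₁, hx₁, L, hL0, hL, hne⟩ hiff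
    rw [h1, h2] at hiff
    have hpar : fires β c (act x) x % 2 = fires β c (act x) (flipAt x {i, j}) % 2 := by omega
    have hS : SysConst β c (act x) x {i, j} := by
      intro x' hx' x'' hx''
      rcases mem_subFibre_pair hN hx hi hj hij hx' with rfl | rfl <;>
        rcases mem_subFibre_pair hN hx hi hj hij hx'' with rfl | rfl <;> first | rfl | exact hpar | exact hpar.symm
    exact hne ((peelList hN β c hC hS hx₁ L hL).2 hL0)
  · intro hne
    have hpar : fires β c (act x) x % 2 ≠ fires β c (act x) (flipAt x {i, j}) % 2 := by
      intro h
      apply hne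
      rw [h1, h2]
      omega
    refine ⟨x, hxm, [(i, j)], List.cons_ne_nil _ _, ⟨fun p hp => ?_, by simp [hij]⟩, ?_⟩
    · rw [List.mem_singleton] at hp
      subst hp
      exact ⟨by simp, by simp⟩
    · have key := fires_flip_pair β c (act x) x hij
      have hsurv : surv β x x [(i, j)] = (act x).filter fun g => dPair β x g i j ≠ 0 := by
        unfold surv
        exact filter_congr fun g _ => by simp
      have hshift : cShift β c x [(i, j)] = fun g => c g + dPair β x g i j := by
        funext g
        simp [cShift]
      rw [hsurv, hshift]
      intro heq
      apply hpar
      omega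

/-- Ordered pair-cut of `W` inside the fibre of `x`: incidences (point `y` of the fibre, coin pair `P`) whose flip crosses `W`. -/
noncomputable def pairCut (x : Fin N → Bool) (W : Finset (Fin N → Bool)) : ℕ :=
  open scoped Classical in
  ∑ y ∈ SubFibre x (klineZeros x),
    ((klineZeros x).powerset.filter fun P => P.card = 2 ∧ ¬ (y ∈ W ↔ flipAt y P ∈ W)).card

/-- **S1b (statement; prover target P-29f):** edge expansion of the pair-flip graph on a fibre with `z` coins —
`4 (z − 1) |W| |F ∖ W| ≤ |F| · pairCut`, sharp at `z = 2, 3` (spectral gap `2(z−1)` of `Cay(even code, pairs)`). -/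
def FibreCutBound : Prop :=
  ∀ N : ℕ, 3 ≤ N → ∀ x : Fin N → Bool, IsOdd x → ∀ W : Finset (Fin N → Bool), W ⊆ SubFibre x (klineZeros x) →
    4 * ((klineZeros x).card - 1) * W.card * (SubFibre x (klineZeros x) \ W).card ≤
      (SubFibre x (klineZeros x)).card * pairCut x W

/-! ### Free-phase purity (the shift-invariance principle; ROUND-28 rev. 3 §6(b) S3′)

If the tests of a set `K` of rows read a COMMON FREE PHASE — `[u_h + t = c_h]` with the same `t ∈ 𝔽₃` for all `h ∈ K`, every `t`
occurring — and the number of firing rows has the same parity `κ` for every `t`, then `κ ≡ |K| (mod 2)`: each row fires for exactly one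
of the three phases.  Consequence (pencil, K-40 confirmed): in any model with a free phase per twin class (run-twin designs with generic
cores; conjecturally every class of WIDE rows of a far strategy), a window-pure class contributes `|K ∩ act|` to the firing parity, so the
win function of a window-pure strategy equals that of the FRAME strategy obtained by replacing every wide row by an always-firing blind
row — and the per-run defect of every pure run-local design is `min_κ P[pairs2_R ≢ κ]`, independent of the design (s = 4: 1/3;
s = 6: 0.4583 — exactly the K-38e / K-40 values), in particular never 0. -/

/-- Each test fires for exactly one of the three phase shifts. -/
theorem shift_cover (a b : ZMod 3) :
    ((if a + 0 = b then 1 else 0) + (if a + 1 = b then 1 else 0) + (if a + 2 = b then 1 else 0) : ℕ) = 1 := by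
  revert a b
  decide

/-- **FREE-PHASE PURITY (PROVED):** constant firing parity under all three phase shifts forces parity `≡ |K|`. -/
theorem freePhase_parity {ι : Type*} (K : Finset ι) (u c : ι → ZMod 3) (κ : ℕ)
    (h : ∀ t : ZMod 3, (K.filter fun i => u i + t = c i).card % 2 = κ % 2) : K.card % 2 = κ % 2 := by
  have hcov : (K.filter fun i => u i + 0 = c i).card + (K.filter fun i => u i + 1 = c i).card +
      (K.filter fun i => u i + 2 = c i).card = K.card := by
    simp only [card_eq_sum_ones, sum_filter]
    rw [← sum_add_distrib, ← sum_add_distrib]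
    exact sum_congr rfl fun i _ => shift_cover (u i) (c i)
  have h0 := h 0
  have h1 := h 1
  have h2 := h 2
  omega

end AffBells29

end Summit.QuantumAdvantage.AdviceFreeQNC0
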